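import Summits.MatrixMultiplication.OmegaCensus.SmallFormats.MatMul22nManyRankOneCensus
import HarnessLib

/-!
# ω-census family (a): a LOADED rank-one plane forces many SINGULAR X-forms at length `3n + 3` (any field)

Cell `pub-omega` (unit `pub-omega-tensor`, gen 38), topic `Summits/MatrixMultiplication/OmegaCensus` (sub-folder
`SmallFormats`). Framing (verbatim): lottery ticket; floor = certified bounds/negative ranges. HONEST FRAMING: a structural theorem
about bilinear algorithms for `⟨2,2,n⟩` of length `3n + 3` over an ARBITRARY field (row 1 of the pattern table of tensor g38's memo
LAW-3M3 §6, now in the kernel); NOT a bound on any rank by itself; nothing here is a bound on `ω`.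

**`RankOneCensus.two_mul_add_card_le_of_loaded_row`**: let `XY = ∑ f_i(X) g_i(Y) W_i` compute `⟨2,2,n⟩` with `3n + 3` terms, `n ≥ 8`,
and let `s` be a set of AT LEAST THREE indices whose coefficient matrices `U_i` lie in one rank-one ROW plane `{U : λᵀ U = 0}`
(`λ ≠ 0`; a 'loaded' plane). Then

  `2n + |s| ≤ #{i : det U_i = 0} + 8`, i.e. at least `2(n − 4) + |s|` X-forms are singular.

Proof: sandwich `U ↦ P U` with `P` invertible of first row `λ` (`exists_xMarginal_eq_sandwich`), transpose to Alekseev's orientation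
with `p_t`, `q_t` = the rows of `P U_t` (`exists_trComp₂`, p720364); for any frame `F`: `|J| ≤ n + 2` (`Frame3m3.card_J_le`, p716980) and
`12n ≤ #{p ∈ I : q_p ∥ p_p} + 4|I| + 2|J|` (`Lemma12Gen.twelve_mul_le`, p719667), so `≥ 2n − 8` frame members have proportional rows —
these have `p_p ≠ 0`, hence are disjoint from `s` (`p = 0` there) — and both kinds have `det (P U_i) = det P · det U_i = 0`; the load
`|s| ≥ 3` forces `|J| = n + 2`, `|I| = 2n + 1` (type-F count p714035), whence `≥ 2n − 5` singular X-forms; the column version follows by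
`exists_xMarginal_eq_transpose`. Over `𝔽₃` at `(8,27)`: `σ ≥ 11 + (load − 3)` rank-one X-forms whenever some plane carries `≥ 3`.
-/

namespace Summit.MatrixMultiplication.OmegaCensus.SmallFormats

open Finset Module Matrix
open Literature.Computability.AlgebraicComplexity
open Summit.MatrixMultiplication.OmegaCensus.RankOnePlaneCapGeneral

namespace RankOneCensus

variable {k : Type*} [Field k] {n : ℕ} {ι : Type*} [Fintype ι]

/-- An invertible `2 × 2` matrix with prescribed nonzero first row (copy of the private helper of `MatMul225FramePlaneCap`). -/
private theorem exists_det_ne_zero_row₅ (lam : Fin 2 → k) (hlam : lam ≠ 0) :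
    ∃ P : Matrix (Fin 2) (Fin 2) k, P.det ≠ 0 ∧ ∀ d, P 0 d = lam d := by
  by_cases h0 : lam 0 = 0
  · have h1 : lam 1 ≠ 0 := by
      intro h1; apply hlam; funext j; fin_cases j <;> simp [h0, h1]
    refine ⟨!![lam 0, lam 1; 1, 0], ?_, fun d => by fin_cases d <;> rfl⟩
    rw [Matrix.det_fin_two_of]; simpa [h0] using h1
  · refine ⟨!![lam 0, lam 1; 0, 1], ?_, fun d => by fin_cases d <;> rfl⟩
    rw [Matrix.det_fin_two_of]; simpa using h0

open scoped Classical in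
/-- **A loaded row plane forces singular X-forms (length `3n + 3`, `n ≥ 8`, any field)**: if the coefficient matrices of the terms in
`s` all satisfy `λᵀ U_i = 0` (`λ ≠ 0`), then `2n + |s| ≤ #{i : det U_i = 0} + 8`. -/
theorem two_mul_add_card_le_of_loaded_row (hn : 8 ≤ n) (β : BilinComp (mulBilin k 2 2 n) ι)
    (hι : Fintype.card ι = 3 * n + 3) (lam : Fin 2 → k) (hlam : lam ≠ 0) (s : Finset ι) (h3 : 3 ≤ s.card)
    (hs : ∀ i ∈ s, Matrix.vecMul lam (xMarginal β i) = 0) :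
    2 * n + s.card ≤ (Finset.univ.filter fun i => (xMarginal β i).det = 0).card + 8 := by
  classical
  obtain ⟨P, hP, hrow⟩ := exists_det_ne_zero_row₅ lam hlam
  obtain ⟨β₁, hβ₁⟩ := exists_xMarginal_eq_sandwich β P 1 hP (by simp)
  obtain ⟨β', hp, hq⟩ := exists_trComp₂ β₁
  obtain ⟨F⟩ := Alekseev2015.exists_frame β'
  -- type-F indices: p = 0 on s
  have hpz : ∀ i ∈ s, Alekseev2015.pvec β' i = 0 := by
    intro i hi
    funext j
    have key : (P * xMarginal β i) 0 j = Matrix.vecMul lam (xMarginal β i) j := by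
      simp only [Matrix.mul_apply, Matrix.vecMul, dotProduct, hrow]
    rw [hp, hβ₁, Matrix.mul_one, key, hs i hi]
  -- frame parameters and the rank-one members
  have hJ := Frame3m3.card_J_le F hn hι.le
  have h12 := Lemma12Gen.twelve_mul_le F
  have hIJ := F.card_I_add_card_J
  have hF := FramePlaneCap.card_add_two_mul_le_two_mul_card_J F s hpz
  -- the two disjoint families of singular X-forms
  let A : Finset ι := F.I.filter fun p => ∃ a : k, Alekseev2015.qvec β' p = a • Alekseev2015.pvec β' p
  have hdisj : Disjoint A s := by
    rw [Finset.disjoint_left]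
    intro i hiA his
    exact F.pvec_ne_zero (Finset.mem_filter.1 hiA).1 (hpz i his)
  have hdet : ∀ i, (P * xMarginal β i).det = 0 → (xMarginal β i).det = 0 := by
    intro i h
    rw [Matrix.det_mul] at h
    rcases mul_eq_zero.1 h with h' | h'
    · exact absurd h' hP
    · exact h'
  -- rows of P U_i are (pvec, qvec)
  have hrows : ∀ i (c : Fin 2), (P * xMarginal β i) 0 c = Alekseev2015.pvec β' i c ∧
      (P * xMarginal β i) 1 c = Alekseev2015.qvec β' i c := by
    intro i c
    constructor
    · rw [hp, hβ₁, Matrix.mul_one]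
    · rw [hq, hβ₁, Matrix.mul_one]
  have hsub : A ∪ s ⊆ Finset.univ.filter fun i => (xMarginal β i).det = 0 := by
    intro i hi
    rw [Finset.mem_filter]
    refine ⟨Finset.mem_univ _, hdet i ?_⟩
    rw [Matrix.det_fin_two]
    rcases Finset.mem_union.1 hi with hiA | his
    · obtain ⟨a, ha⟩ := (Finset.mem_filter.1 hiA).2
      have e0 := (hrows i 0).2; have e1 := (hrows i 1).2
      have f0 := (hrows i 0).1; have f1 := (hrows i 1).1
      rw [e0, e1, f0, f1, ha, Pi.smul_apply, Pi.smul_apply, smul_eq_mul, smul_eq_mul]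
      ring
    · have f0 := (hrows i 0).1; have f1 := (hrows i 1).1
      rw [f0, f1, hpz i his]
      simp
  have hcard := Finset.card_le_card hsub
  rw [Finset.card_union_of_disjoint hdisj] at hcard
  have hAb : A.card = (F.I.filter fun p => ∃ a : k, Alekseev2015.qvec β' p = a • Alekseev2015.pvec β' p).card := rfl
  omega

open scoped Classical in
/-- **Column version**: if `U_i λ = 0` for all `i ∈ s` (`λ ≠ 0`, `|s| ≥ 3`), then `2n + |s| ≤ #{i : det U_i = 0} + 8` (transpose-dual symmetry). -/
theorem two_mul_add_card_le_of_loaded_col (hn : 8 ≤ n) (β : BilinComp (mulBilin k 2 2 n) ι)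
    (hι : Fintype.card ι = 3 * n + 3) (lam : Fin 2 → k) (hlam : lam ≠ 0) (s : Finset ι) (h3 : 3 ≤ s.card)
    (hs : ∀ i ∈ s, Matrix.mulVec (xMarginal β i) lam = 0) :
    2 * n + s.card ≤ (Finset.univ.filter fun i => (xMarginal β i).det = 0).card + 8 := by
  classical
  obtain ⟨β₁, hβ₁⟩ := exists_xMarginal_eq_transpose β
  have h := two_mul_add_card_le_of_loaded_row hn β₁ hι lam hlam s h3 fun i hi => by
    rw [hβ₁, Matrix.vecMul_transpose, hs i hi]
  have e : (Finset.univ.filter fun i => (xMarginal β₁ i).det = 0) =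
      Finset.univ.filter fun i => (xMarginal β i).det = 0 := by
    refine Finset.filter_congr fun i _ => ?_
    rw [hβ₁, Matrix.det_transpose]
  rw [e] at h
  exact h

end RankOneCensus

end Summit.MatrixMultiplication.OmegaCensus.SmallFormats
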